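import Mathlib.RingTheory.EssentialFiniteness
import Mathlib.FieldTheory.IntermediateField.Adjoin.Algebra
import Literature.AlgebraicGeometry.Resolution.RankOneReductionProofs
import Literature.AlgebraicGeometry.Resolution.LocalUniformization
import Summits.ResolutionOfSingularities.ResolutionOfSingularities.Theses.Valuative
import Summits.ResolutionOfSingularities.ResolutionOfSingularities.Theorems.ValuativeRankOneReductionRemodel
import HarnessLib

/-!
# `RankOneReduction` (item stmt-ResolutionOfSingularities-0563): the absolute rank-one reduction

PROOF of the route decl `Theses.Valuative.RankOneReduction` of route
`ResolutionOfSingularities/Valuative`: for every prime `p`, if ABSOLUTE local uniformization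
(a finitely generated `A ⊆ O` with `Frac A = K`, regular at the centre `m_O ∩ A`) holds for every
RANK-ONE valuation ring `O ⊇ k` of every finitely generated `K/k` with `char k = p`, then it
holds for every valuation ring.

The argument is Novacoski–Spivakovsky's induction on the rank (arXiv:1204.4751, §3.1, as
formalised in `Literature.AlgebraicGeometry.Resolution.NovacoskiSpivakovsky2014_holds` for the
RELATIVE property), made absolute by the re-modelling device of
`Theorems.ValuativeRankOneReductionRemodel`: for `ν = ν₁ ∘ ν₂` (`O < O₁ < K`), absolute LU of
`ν₁` (induction) gives a regular local ring `L` dominated by `O₁`; absolute LU of `ν₂`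
restricted to the residue field of `L` (induction, on the subfield `Frac Φ(A₀) ⊆ κ(O₁)`) gives a
regular model `B` there; `L` is re-modelled by a finitely generated `A ⊆ O` with `Φ(A) = B`
(`exists_remodel`), and the final blowing-up
`Literature.AlgebraicGeometry.Resolution.novacoskiSpivakovsky2014_step` makes `A` regular at the
centre of `ν`. Rank `0` is `relLocalUniformization_top`, rank `1` the hypothesis
(`nonempty_rankOne_of_overrings`); the rank is finite by `finite_overrings_of_fg`. In
particular the absolute reduction is a theorem of the same formal strength as the relative one
(the base field `k` is even kept fixed throughout).
-/

set_option linter.dupNamespace false  -- Summit.<S>.<S>.Theorems is the D-0017 layout (single-conjunct summit)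

noncomputable section

open IsLocalRing
open Literature.AlgebraicGeometry.Resolution

namespace Summit.ResolutionOfSingularities.ResolutionOfSingularities.Theorems

/-- A field with an affine model (a finitely generated subalgebra `R` with `Frac R = K`) is a
finitely generated field extension. [folklore] -/
theorem intermediateField_fg_top_of_model {k K : Type} [Field k] [Field K] [Algebra k K]
    (R : Subalgebra k K) (hR : R.FG) [IsFractionRing R K] : (⊤ : IntermediateField k K).FG := by
  haveI : Algebra.FiniteType k R := R.fg_iff_finiteType.mp hR
  haveI : Algebra.EssFiniteType R K :=
    Algebra.EssFiniteType.of_isLocalization K (nonZeroDivisors R)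
  haveI : Algebra.EssFiniteType k K := Algebra.EssFiniteType.comp k R K
  exact IntermediateField.fg_top k K

/-- **Absolute local uniformization of all valuation rings from the rank-one ones**, the
induction on the number of overrings (= rank + 1) for a fixed base field `k`: if every rank-one
valuation ring `O ⊇ k` of every finitely generated `K/k` contains a finitely generated `A` with
`Frac A = K`, regular at the centre, then so does every valuation ring `O ⊇ k` of a field `K`
having an affine model over `k`. Rank `0`: the model itself; rank `1`: the hypothesis; rank
`≥ 2`: `ν = ν₁ ∘ ν₂` along `O < O₁ < K`, induction for `ν₁` and for the restrictions of `ν₂`,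
re-modelling (`exists_remodel`) and Novacoski–Spivakovsky's final blowing up
(`novacoskiSpivakovsky2014_step`). [folklore] -/
theorem exists_regular_model_of_rankOne {k : Type} [Field k]
    (hrank1 : ∀ (K : Type) [Field K] [Algebra k K], (⊤ : IntermediateField k K).FG →
      ∀ O : ValuationSubring K, (∀ c : k, algebraMap k K c ∈ O) →
      Nonempty O.valuation.RankOne →
      ∃ (A : Subalgebra k K) (h : A.toSubring ≤ O.toSubring), A.FG ∧ IsFractionRing A K ∧
        IsRegularLocalRing (Localization.AtPrime
          (Ideal.comap (Subring.inclusion h) (IsLocalRing.maximalIdeal O))))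
    (n : ℕ) : ∀ (K : Type) [Field K] [Algebra k K] (O : ValuationSubring K),
      (∀ c : k, algebraMap k K c ∈ O) → (∃ R : Subalgebra k K, R.FG ∧ IsFractionRing R K) →
      Finite {S : ValuationSubring K // O ≤ S} →
      Nat.card {S : ValuationSubring K // O ≤ S} = n →
      ∃ (A : Subalgebra k K) (h : A.toSubring ≤ O.toSubring), A.FG ∧ IsFractionRing A K ∧
        IsRegularLocalRing (Localization.AtPrime
          (Ideal.comap (Subring.inclusion h) (IsLocalRing.maximalIdeal O))) := by
  induction n using Nat.strong_induction_on with
  | _ n ih => ?_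
  intro K _ _ O hk hR hfin hn
  obtain ⟨R, hRfg, hRfrac⟩ := hR
  haveI := hRfrac
  -- rank zero: the trivial valuation ring
  by_cases htop : O = ⊤
  · subst htop
    have hRO : R.toSubring ≤ (⊤ : ValuationSubring K).toSubring := fun x _ =>
      ValuationSubring.mem_top x
    obtain ⟨A, hA, hRA, hAfg, hreg⟩ := relLocalUniformization_top R hRfg hRfrac hRO
    exact ⟨A, hA, hAfg, isFractionRing_subalgebra_of_le R A hRA, hreg⟩
  -- rank one: the hypothesis
  by_cases h2 : ∀ S : ValuationSubring K, O ≤ S → S = O ∨ S = ⊤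
  · exact hrank1 K (intermediateField_fg_top_of_model R hRfg) O hk
      (nonempty_rankOne_of_overrings O htop h2)
  push Not at h2
  obtain ⟨O₁, hO, hne, hne_top⟩ := h2
  -- induction hypothesis for `ν₁`: an absolute regular model of `O₁`
  have ih₁ : ∃ (A₀ : Subalgebra k K) (h : A₀.toSubring ≤ O₁.toSubring), A₀.FG ∧
      IsFractionRing A₀ K ∧ IsRegularLocalRing (Localization.AtPrime
        (Ideal.comap (Subring.inclusion h) (IsLocalRing.maximalIdeal O₁))) := by
    have hlt : Nat.card {S : ValuationSubring K // O₁ ≤ S} < n := by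
      rw [← hn, ← ValuationSubring.ofPrime_idealOfLE O O₁ hO]
      exact card_overrings_ofPrime_lt O _ (idealOfLE_ne_maximalIdeal O O₁ hO hne)
    haveI : Finite {S : ValuationSubring K // O₁ ≤ S} := by
      rw [← ValuationSubring.ofPrime_idealOfLE O O₁ hO]; infer_instance
    exact ih _ hlt K O₁ (fun c => hO (hk c)) ⟨R, hRfg, hRfrac⟩ this rfl
  obtain ⟨A₀, hA₀, hA₀fg, hfrac₀, hreg₀⟩ := ih₁
  -- induction hypothesis for the restrictions of `ν₂`
  have ih₂ : ∀ (κ : Type) [Field κ] [Algebra k κ] (ι : κ →+* ResidueField O₁),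
      (∀ c : k, algebraMap k κ c ∈ (residueValuationSubring O O₁ hO).comap ι) →
      (∃ R : Subalgebra k κ, R.FG ∧ IsFractionRing R κ) →
      ∃ (B : Subalgebra k κ)
        (hB : B.toSubring ≤ ((residueValuationSubring O O₁ hO).comap ι).toSubring),
        B.FG ∧ IsFractionRing B κ ∧
        IsRegularLocalRing (Localization.AtPrime
          ((maximalIdeal ((residueValuationSubring O O₁ hO).comap ι)).comap
            (Subring.inclusion hB))) := by
    intro κ _ _ ι hkκ hRκ
    have hlt2 := card_overrings_residue_lt O O₁ hO hne_top
    have hle := card_overrings_comap_le (residueValuationSubring O O₁ hO) ι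
    exact ih _ (hn ▸ lt_of_le_of_lt hle hlt2) κ _ hkκ hRκ inferInstance rfl
  -- re-modelling and the final blowing up
  obtain ⟨A, hA, hAfg, hfracA, hregP, hregQ⟩ :=
    exists_remodel O O₁ hO hk A₀ hA₀ hA₀fg hfrac₀ hreg₀ ih₂
  obtain ⟨A', hA', hAA', hA'fg, hreg'⟩ :=
    novacoskiSpivakovsky2014_step O O₁ hO A hA hAfg hfracA hregP hregQ
  haveI := hfracA
  exact ⟨A', hA', hA'fg, isFractionRing_subalgebra_of_le A A' hAA', hreg'⟩

/-- **`RankOneReduction` holds** (item stmt-ResolutionOfSingularities-0563, route `Valuative`):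
for every prime `p`, absolute local uniformization of all RANK-ONE valuation rings
(`Nonempty O.valuation.RankOne`) of finitely generated `K/k` with `char k = p` implies absolute
local uniformization of ALL valuation rings of such `K/k`. Proof: an affine model inside `O`
(`exists_affineModel`), finiteness of the rank (`finite_overrings_of_fg`) and the induction
`exists_regular_model_of_rankOne` (the base field, hence its characteristic, is kept fixed).
[folklore] -/
theorem rankOneReduction_proof :
    Summit.ResolutionOfSingularities.ResolutionOfSingularities.Theses.Valuative.RankOneReduction := by
  intro p _ hrank1 k K _ _ _ _ hfg O hk
  obtain ⟨R, -, hRfg, hRfrac⟩ := exists_affineModel k K hfg O hk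
  haveI := hRfrac
  have hfin := finite_overrings_of_fg O hk R hRfg
  exact exists_regular_model_of_rankOne (fun K _ _ => hrank1 k K) _ K O hk ⟨R, hRfg, hRfrac⟩
    hfin rfl

end Summit.ResolutionOfSingularities.ResolutionOfSingularities.Theorems

end
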